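import Summits.QuantumFields.YangMills.Theorems.UV3BranchExpansionMuteCancellation
import HarnessLib

/-!
# R3 (cell `ym3-torus`, YM₃ on T³ — a ladder RUNG, NOT d = 4, NOT infinite volume, NOT a mass gap, NOT the Clay problem) —
# **(F-M2c) THE MUTE CANCELLATION, DEAD-TOWER CASE: if the Dist-tower above a mute site DIES unread (its last bond lies on no segment, below the top),
# the two branch integrands coincide POINTWISE — no slot, no Fubini (remark (d) of the note)**

Width seat `ym3-torus-px8` g13 on crux `stmt-QuantumFields-19936` `UnitScaleTilt.HistoryTailL` (`--supports`, helper; THEOREMS ONLY, 0 `def`, 0 `sorry`,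
default heartbeats).  Complement of ✓`UV3BranchExpansionMuteCancellation` ((F-M2b), the EXIT case `t (m+1) ∉ Dist`): LEAD ★w1-19936 g12's note
`Cruxes/HistoryTailL/HTopBranchExpansion.md` §4 defines `Desc(σ)` as the maximal initial piece of the tower inside `Dist`, ending EITHER at the first tower bond outside `Dist`
(exit — (F-M2b)) OR where the tower STOPS because its last bond `t m` lies on no straight segment (dead — this file).  In the dead case the branch value at `σ` influences
nothing above height `m`: no segment contains `t m`, no constrained guard reads the tower (muteness), and `m < n` (the test function lives at the top).  RECORD CURRENCY:
record-independent kinematics; read by no row of the χ record `AlphaInputsT3ACv4RecChi`; nothing of hTop, of the record, of `HistoryTailL` or of rung R3 is proved here.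

CONTENTS (letters of (F-M2a)∕(F-M2b): relative heights, slices `S₁, S₂ ⊆ Sc` agreeing except at `c` on height `κ`, trajectories `V₁, V₂`):
* ★★ `integrand_eq_of_deadTower` — POINTWISE `1[guards of Sc fire along V₁]·g (V₁ n U) = 1[… V₂ …]·g (V₂ n U)` under: tower `t (κ+1) = c`, `t i = line (t (i+1)) (τ i)`
  (`κ+1 ≤ i < m`), unread by the guards of `Sc i` (`κ+1 ≤ i ≤ m`), DEAD at `m` (`∀ C t′, t′ < L → line C t′ ≠ t m`), `m + 1 ≤ n` (✓`traj_congr_off_cone` with the cone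
  `{t i | κ+1 ≤ i ≤ m}`, empty at height `m+1`; ✓`traj_congr_above` beyond; ✓`small_congr_off` below);
* ★★ `lintegral_guardAll_mul_eq_of_deadTower`, ★★ `measure_guardAll_inter_preimage_eq_of_deadTower` (integral ∕ set forms);
* ★★★ `socket_hM_of_deadTower` — the `hM` binder of LEAD's socket ✓`UV3BranchExpansionGuardedTower.map_iterFrom_le_smul_of_branchExpansion` per DEAD mute site, in the
  socket's own sigma letters (as ✓`…MuteCancellation.socket_hM_of_mute` for the exit case).

HONEST SCOPE.  [folklore] bookkeeping over (F-M2a)∕(F-M2b) by name; 0 `def`, 0 `instance`, standard axioms; muteness = displayed lattice HYPOTHESES.  Nothing of hTop ∕ (C′) ∕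
(A) ∕ the χ record ∕ (O‴χₛ) ∕ `HistoryTailL` (19936) ∕ rung R3 is proved; R3 = SU(2) YM₃ on T³ — NOT d = 4, NOT infinite volume, NOT a mass gap, NOT Clay; the YM mass gap is NOT
proved.  References: T. Bałaban, Commun. Math. Phys. **109** (1987) 249–301 [Balaban1987RG1] ((0.4) p. 253); T. Bałaban, Commun. Math. Phys. **95** (1984) 17–40
[Balaban1984PropagatorsI] ((1.7) p. 18); LEAD note §4 (M) remark (d).
-/

set_option autoImplicit false

noncomputable section

open MeasureTheory Function
open scoped ENNReal

namespace Summit.QuantumFields.YangMills.Theorems.UV3BranchExpansionMuteCancellationDead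

open Literature.MathematicalPhysics.QuantumFieldTheory.Balaban1983to89
open Literature.MathematicalPhysics.QuantumFieldTheory.Balaban1983to89.AveragingRT
open Literature.MathematicalPhysics.QuantumFieldTheory.Balaban1983to89.T4Continuum (walk loopWord)
open Literature.MathematicalPhysics.QuantumFieldTheory.Balaban1983to89.BlockAveraging (Idx off Small avgFun measurableSet_small)
open Summit.QuantumFields.YangMills.Theorems.UV3BranchExpansionTrajectorySupport
open Summit.QuantumFields.YangMills.Theorems.UV3BranchExpansionMuteCancellation (traj_congr_above)
open Summit.QuantumFields.YangMills.Theorems.UV3AxialLaunderingFreeSlot (line_inj)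

variable {P : Params} {G : Type*} [GaugeGroup G] (ℰ : LoopAverage G) [∀ k, DecidableEq (PBond P k)] {j n : ℕ}

/-- ★★ **DEAD TOWER ⇒ THE INTEGRANDS COINCIDE POINTWISE.**  Slices `S₁, S₂ ⊆ Sc` differing only at `c` on height `κ`; the tower `t (κ+1) = c, …, t m` (each on the segment of
the next) is unread by the guards of `Sc` at its heights and DIES at `m`: no segment of height `m+1` contains `t m`; `m + 1 ≤ n`.  Then for every `U` and every test `g`,
`1[∀ i<n, ∀ c′ ∈ Sc i, Small ℰ (V₁ i U) c′]·g (V₁ n U) = 1[… V₂ …]·g (V₂ n U)`. [cite: Balaban1987RG1, (0.4) p.253] -/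
theorem integrand_eq_of_deadTower (Sc S₁ S₂ : (i : ℕ) → Finset (PBond P (j + i + 1))) (hS₁ : ∀ i, i < n → S₁ i ⊆ Sc i)
    (V₁ V₂ : (i : ℕ) → GaugeField P j G → GaugeField P (j + i) G) (hV₁0 : ∀ U, V₁ 0 U = U) (hV₂0 : ∀ U, V₂ 0 U = U)
    (hV₁s : ∀ i, i < n → ∀ U, V₁ (i + 1) U = fun C => if C ∈ S₁ i then avgFun ℰ (V₁ i U) C else axialAvg (V₁ i U) C)
    (hV₂s : ∀ i, i < n → ∀ U, V₂ (i + 1) U = fun C => if C ∈ S₂ i then avgFun ℰ (V₂ i U) C else axialAvg (V₂ i U) C)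
    (hjn : j + n ≤ P.m + P.K) {κ m : ℕ} (hκm : κ + 1 ≤ m) (hmn : m + 1 ≤ n) (c : PBond P (j + κ + 1))
    (hs : ∀ i, i ≠ κ → S₁ i = S₂ i) (hsκ : ∀ C : PBond P (j + κ + 1), C ≠ c → (C ∈ S₁ κ ↔ C ∈ S₂ κ))
    (t : (i : ℕ) → PBond P (j + i)) (τ : ℕ → ℕ) (htc : t (κ + 1) = c)
    (htower : ∀ i, κ + 1 ≤ i → i < m → τ i < P.L ∧ t i = line (t (i + 1)) (τ i))
    (htunread : ∀ i, κ + 1 ≤ i → i < m + 1 → ∀ C ∈ Sc i, ∀ (ι : Idx P), ∀ st ∈ walk (emb C.src) (loopWord P.L C.dir (off ι.1) ι.2.1 ι.2.2), st.bond ≠ t i)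
    (hdead : ∀ C : PBond P (j + m + 1), ∀ t', t' < P.L → line C t' ≠ t m)
    (g : GaugeField P (j + n) G → ℝ≥0∞) (U : GaugeField P j G) :
    {U : GaugeField P j G | ∀ i, i < n → ∀ c' ∈ Sc i, Small ℰ (V₁ i U) c'}.indicator 1 U * g (V₁ n U) =
      {U : GaugeField P j G | ∀ i, i < n → ∀ c' ∈ Sc i, Small ℰ (V₂ i U) c'}.indicator 1 U * g (V₂ n U) := by
  -- the cone: the tower bonds at the heights `κ+1 … m`, nothing at height `m+1`
  have hcone := traj_congr_off_cone ℰ S₁ S₂ V₁ V₂ hV₁0 hV₂0 (N := m + 1) (fun i hi U => hV₁s i (by omega) U) (fun i hi U => hV₂s i (by omega) U)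
    (fun i => {C | κ + 1 ≤ i ∧ i ≤ m ∧ C = t i}) (U₁ := U) (U₂ := U) (fun _ _ => rfl) ?_
  swap
  · intro i hi C hC'
    have hC : ∀ (h1 : κ + 1 ≤ i + 1) (h2 : i + 1 ≤ m), C ≠ t (i + 1) := fun h1 h2 h3 => hC' ⟨h1, h2, h3⟩
    refine ⟨?_, ?_, ?_⟩
    · by_cases hiκ : i = κ
      · subst hiκ
        exact hsκ C fun hCc => hC le_rfl hκm (by rw [htc]; exact hCc)
      · rw [hs i hiκ]
    · rintro t' ht' ⟨hi1, hi2, hmem⟩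
      rcases Nat.lt_or_ge i m with hlt | hge
      · obtain ⟨hτ, hti⟩ := htower i hi1 hlt
        have hmem' : line C t' = line (t (i + 1)) (τ i) := by rw [← hti]; exact hmem
        exact hC (by omega) (by omega) (line_inj (j := j + i) (show j + i + 1 ≤ P.m + P.K by omega) ht' hτ hmem').1
      · obtain rfl : i = m := le_antisymm hi2 hge
        exact hdead C t' ht' hmem
    · rintro hCs ι st hst ⟨hi1, hi2, hmem⟩
      exact htunread i hi1 (by omega) C (hS₁ i (by omega) hCs) ι st hst hmem
  -- at height `m+1` the trajectories coincide, hence above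
  have hm1 : V₁ (m + 1) U = V₂ (m + 1) U := funext fun C => hcone (m + 1) le_rfl C fun ⟨_, h2, _⟩ => by omega
  have habove : ∀ i, m + 1 ≤ i → i ≤ n → V₁ i U = V₂ i U :=
    traj_congr_above ℰ S₁ S₂ V₁ V₂ hV₁s hV₂s (n₀ := m + 1) (fun i hi _ => hs i (by omega)) hm1
  -- the guard events agree
  have hguards : (∀ i, i < n → ∀ c' ∈ Sc i, Small ℰ (V₁ i U) c') ↔ (∀ i, i < n → ∀ c' ∈ Sc i, Small ℰ (V₂ i U) c') := by
    refine forall_congr' fun i => forall_congr' fun hi => forall_congr' fun c' => forall_congr' fun hc' => ?_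
    rcases Nat.lt_or_ge i (m + 1) with hlt | hge
    · refine small_congr_off ℰ {C | κ + 1 ≤ i ∧ i ≤ m ∧ C = t i} (fun C hC => hcone i hlt.le C hC) c' fun ι st hst hmem => ?_
      obtain ⟨hi1, _, hmem⟩ := hmem
      exact htunread i hi1 hlt c' hc' ι st hst hmem
    · rw [habove i hge hi.le]
  rw [habove n hmn le_rfl]
  congr 1
  by_cases hev : ∀ i, i < n → ∀ c' ∈ Sc i, Small ℰ (V₂ i U) c'
  · rw [Set.indicator_of_mem (show U ∈ {U : GaugeField P j G | ∀ i, i < n → ∀ c' ∈ Sc i, Small ℰ (V₁ i U) c'} from hguards.2 hev),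
      Set.indicator_of_mem (show U ∈ {U : GaugeField P j G | ∀ i, i < n → ∀ c' ∈ Sc i, Small ℰ (V₂ i U) c'} from hev)]
  · rw [Set.indicator_of_notMem (show U ∉ {U : GaugeField P j G | ∀ i, i < n → ∀ c' ∈ Sc i, Small ℰ (V₁ i U) c'} from fun h => hev (hguards.1 h)),
      Set.indicator_of_notMem (show U ∉ {U : GaugeField P j G | ∀ i, i < n → ∀ c' ∈ Sc i, Small ℰ (V₂ i U) c'} from hev)]

variable [MeasurableSpace G]

/-- ★★ **DEAD TOWER, INTEGRAL FORM**: the two guarded, tested integrals coincide. [cite: Balaban1987RG1, (0.4) p.253] -/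
theorem lintegral_guardAll_mul_eq_of_deadTower (Sc S₁ S₂ : (i : ℕ) → Finset (PBond P (j + i + 1))) (hS₁ : ∀ i, i < n → S₁ i ⊆ Sc i)
    (V₁ V₂ : (i : ℕ) → GaugeField P j G → GaugeField P (j + i) G) (hV₁0 : ∀ U, V₁ 0 U = U) (hV₂0 : ∀ U, V₂ 0 U = U)
    (hV₁s : ∀ i, i < n → ∀ U, V₁ (i + 1) U = fun C => if C ∈ S₁ i then avgFun ℰ (V₁ i U) C else axialAvg (V₁ i U) C)
    (hV₂s : ∀ i, i < n → ∀ U, V₂ (i + 1) U = fun C => if C ∈ S₂ i then avgFun ℰ (V₂ i U) C else axialAvg (V₂ i U) C)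
    (hjn : j + n ≤ P.m + P.K) {κ m : ℕ} (hκm : κ + 1 ≤ m) (hmn : m + 1 ≤ n) (c : PBond P (j + κ + 1))
    (hs : ∀ i, i ≠ κ → S₁ i = S₂ i) (hsκ : ∀ C : PBond P (j + κ + 1), C ≠ c → (C ∈ S₁ κ ↔ C ∈ S₂ κ))
    (t : (i : ℕ) → PBond P (j + i)) (τ : ℕ → ℕ) (htc : t (κ + 1) = c)
    (htower : ∀ i, κ + 1 ≤ i → i < m → τ i < P.L ∧ t i = line (t (i + 1)) (τ i))
    (htunread : ∀ i, κ + 1 ≤ i → i < m + 1 → ∀ C ∈ Sc i, ∀ (ι : Idx P), ∀ st ∈ walk (emb C.src) (loopWord P.L C.dir (off ι.1) ι.2.1 ι.2.2), st.bond ≠ t i)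
    (hdead : ∀ C : PBond P (j + m + 1), ∀ t', t' < P.L → line C t' ≠ t m)
    (g : GaugeField P (j + n) G → ℝ≥0∞) (μ : Measure (GaugeField P j G)) :
    ∫⁻ U, {U : GaugeField P j G | ∀ i, i < n → ∀ c' ∈ Sc i, Small ℰ (V₁ i U) c'}.indicator 1 U * g (V₁ n U) ∂μ =
      ∫⁻ U, {U : GaugeField P j G | ∀ i, i < n → ∀ c' ∈ Sc i, Small ℰ (V₂ i U) c'}.indicator 1 U * g (V₂ n U) ∂μ :=
  lintegral_congr fun U => integrand_eq_of_deadTower ℰ Sc S₁ S₂ hS₁ V₁ V₂ hV₁0 hV₂0 hV₁s hV₂s hjn hκm hmn c hs hsκ t τ htc htower htunread hdead g U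

/-- ★★ **DEAD TOWER, SET FORM**: the two guarded events intersected with the preimages of any `B` have the same measure (the integrands are the indicators). [cite: Balaban1987RG1, (0.4) p.253] -/
theorem measure_guardAll_inter_preimage_eq_of_deadTower (Sc S₁ S₂ : (i : ℕ) → Finset (PBond P (j + i + 1))) (hS₁ : ∀ i, i < n → S₁ i ⊆ Sc i)
    (V₁ V₂ : (i : ℕ) → GaugeField P j G → GaugeField P (j + i) G) (hV₁0 : ∀ U, V₁ 0 U = U) (hV₂0 : ∀ U, V₂ 0 U = U)
    (hV₁s : ∀ i, i < n → ∀ U, V₁ (i + 1) U = fun C => if C ∈ S₁ i then avgFun ℰ (V₁ i U) C else axialAvg (V₁ i U) C)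
    (hV₂s : ∀ i, i < n → ∀ U, V₂ (i + 1) U = fun C => if C ∈ S₂ i then avgFun ℰ (V₂ i U) C else axialAvg (V₂ i U) C)
    (hjn : j + n ≤ P.m + P.K) {κ m : ℕ} (hκm : κ + 1 ≤ m) (hmn : m + 1 ≤ n) (c : PBond P (j + κ + 1))
    (hs : ∀ i, i ≠ κ → S₁ i = S₂ i) (hsκ : ∀ C : PBond P (j + κ + 1), C ≠ c → (C ∈ S₁ κ ↔ C ∈ S₂ κ))
    (t : (i : ℕ) → PBond P (j + i)) (τ : ℕ → ℕ) (htc : t (κ + 1) = c)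
    (htower : ∀ i, κ + 1 ≤ i → i < m → τ i < P.L ∧ t i = line (t (i + 1)) (τ i))
    (htunread : ∀ i, κ + 1 ≤ i → i < m + 1 → ∀ C ∈ Sc i, ∀ (ι : Idx P), ∀ st ∈ walk (emb C.src) (loopWord P.L C.dir (off ι.1) ι.2.1 ι.2.2), st.bond ≠ t i)
    (hdead : ∀ C : PBond P (j + m + 1), ∀ t', t' < P.L → line C t' ≠ t m)
    (B : Set (GaugeField P (j + n) G)) (μ : Measure (GaugeField P j G)) :
    μ ({U : GaugeField P j G | ∀ i, i < n → ∀ c' ∈ Sc i, Small ℰ (V₁ i U) c'} ∩ V₁ n ⁻¹' B) =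
      μ ({U : GaugeField P j G | ∀ i, i < n → ∀ c' ∈ Sc i, Small ℰ (V₂ i U) c'} ∩ V₂ n ⁻¹' B) := by
  congr 1
  ext U
  have h := integrand_eq_of_deadTower ℰ Sc S₁ S₂ hS₁ V₁ V₂ hV₁0 hV₂0 hV₁s hV₂s hjn hκm hmn c hs hsκ t τ htc htower htunread hdead (B.indicator 1) U
  have key : ∀ (E : Set (GaugeField P j G)) (f : GaugeField P j G → GaugeField P (j + n) G),
      U ∈ E ∩ f ⁻¹' B ↔ E.indicator (1 : GaugeField P j G → ℝ≥0∞) U * B.indicator 1 (f U) = 1 := by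
    intro E f
    by_cases hE : U ∈ E <;> by_cases hB : f U ∈ B <;>
      simp [Set.indicator_of_mem, Set.indicator_of_notMem, hE, hB, Set.mem_inter_iff, Set.mem_preimage]
  rw [key, key, h]

/-- ★★★ **`hM` OF THE SOCKET AT A DEAD MUTE SITE, IN THE SOCKET'S OWN LETTERS** (companion of ✓`…MuteCancellation.socket_hM_of_mute`): histories = finsets of
`σ : Σ i : Fin n, PBond P (j+i+1)`, `V s` the hybrid trajectory (`hV0`, `hVs` VERBATIM as in ✓`UV3BranchExpansionGuardedTower.map_iterFrom_le_smul_of_branchExpansion`); for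
`s′ ⊆ s` and `σ = ⟨⟨κ,hκ⟩,c⟩ ∈ s` with a DEAD unread tower `t (κ+1) = c, …, t m` (`κ+1 ≤ m`, `m+1 ≤ n`; unread by the guards of `s`; no segment of height `m+1` contains `t m`):
`dU_j ((⋂ τ ∈ s, {U | Small ℰ (V (insert σ s′) τ.1 U) τ.2}) ∩ V (insert σ s′) n ⁻¹' B) = dU_j ((⋂ τ ∈ s, {…V s′…}) ∩ V s′ n ⁻¹' B)`. [cite: Balaban1987RG1, (0.4) p.253] -/
theorem socket_hM_of_deadTower [HaarData G]
    (V : Finset (Σ i : Fin n, PBond P (j + i + 1)) → (i : ℕ) → GaugeField P j G → GaugeField P (j + i) G)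
    (hV0 : ∀ s U, V s 0 U = U)
    (hVs : ∀ s (i : ℕ) (hi : i < n) U, V s (i + 1) U = fun c =>
      if c ∈ (Finset.univ.filter fun c' => (⟨⟨i, hi⟩, c'⟩ : Σ i : Fin n, PBond P (j + i + 1)) ∈ s) then avgFun ℰ (V s i U) c else axialAvg (V s i U) c)
    (hjn : j + n ≤ P.m + P.K) (s s' : Finset (Σ i : Fin n, PBond P (j + i + 1))) (hs's : s' ⊆ s)
    {κ : ℕ} (hκ : κ < n) (c : PBond P (j + κ + 1)) (hσs : (⟨⟨κ, hκ⟩, c⟩ : Σ i : Fin n, PBond P (j + i + 1)) ∈ s)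
    {m : ℕ} (hκm : κ + 1 ≤ m) (hmn : m + 1 ≤ n)
    (t : (i : ℕ) → PBond P (j + i)) (τ : ℕ → ℕ) (htc : t (κ + 1) = c)
    (htower : ∀ i, κ + 1 ≤ i → i < m → τ i < P.L ∧ t i = line (t (i + 1)) (τ i))
    (htunread : ∀ (i : ℕ) (hi1 : κ + 1 ≤ i) (hi2 : i < m + 1), ∀ C : PBond P (j + i + 1),
      (⟨⟨i, by omega⟩, C⟩ : Σ i : Fin n, PBond P (j + i + 1)) ∈ s →
        ∀ (ι : Idx P), ∀ st ∈ walk (emb C.src) (loopWord P.L C.dir (off ι.1) ι.2.1 ι.2.2), st.bond ≠ t i)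
    (hdead : ∀ C : PBond P (j + m + 1), ∀ t', t' < P.L → line C t' ≠ t m)
    (B : Set (GaugeField P (j + n) G)) :
    fieldMeasure P j G ((⋂ τ ∈ s, {U : GaugeField P j G | Small ℰ (V (insert ⟨⟨κ, hκ⟩, c⟩ s') τ.1 U) τ.2}) ∩ V (insert ⟨⟨κ, hκ⟩, c⟩ s') n ⁻¹' B) =
      fieldMeasure P j G ((⋂ τ ∈ s, {U : GaugeField P j G | Small ℰ (V s' τ.1 U) τ.2}) ∩ V s' n ⁻¹' B) := by
  set σ : Σ i : Fin n, PBond P (j + i + 1) := ⟨⟨κ, hκ⟩, c⟩ with hσ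
  set Sc : (i : ℕ) → Finset (PBond P (j + i + 1)) := fun i =>
    if hi : i < n then Finset.univ.filter fun c' => (⟨⟨i, hi⟩, c'⟩ : Σ i : Fin n, PBond P (j + i + 1)) ∈ s else ∅ with hSc
  set S₁ : (i : ℕ) → Finset (PBond P (j + i + 1)) := fun i =>
    if hi : i < n then Finset.univ.filter fun c' => (⟨⟨i, hi⟩, c'⟩ : Σ i : Fin n, PBond P (j + i + 1)) ∈ insert σ s' else ∅ with hS₁
  set S₂ : (i : ℕ) → Finset (PBond P (j + i + 1)) := fun i =>
    if hi : i < n then Finset.univ.filter fun c' => (⟨⟨i, hi⟩, c'⟩ : Σ i : Fin n, PBond P (j + i + 1)) ∈ s' else ∅ with hS₂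
  have memSc : ∀ (i : ℕ) (hi : i < n) (C : PBond P (j + i + 1)), C ∈ Sc i ↔ (⟨⟨i, hi⟩, C⟩ : Σ i : Fin n, PBond P (j + i + 1)) ∈ s := by
    intro i hi C; simp only [hSc, dif_pos hi, Finset.mem_filter, Finset.mem_univ, true_and]
  have memS₁ : ∀ (i : ℕ) (hi : i < n) (C : PBond P (j + i + 1)), C ∈ S₁ i ↔ (⟨⟨i, hi⟩, C⟩ : Σ i : Fin n, PBond P (j + i + 1)) ∈ insert σ s' := by
    intro i hi C; simp only [hS₁, dif_pos hi, Finset.mem_filter, Finset.mem_univ, true_and]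
  have memS₂ : ∀ (i : ℕ) (hi : i < n) (C : PBond P (j + i + 1)), C ∈ S₂ i ↔ (⟨⟨i, hi⟩, C⟩ : Σ i : Fin n, PBond P (j + i + 1)) ∈ s' := by
    intro i hi C; simp only [hS₂, dif_pos hi, Finset.mem_filter, Finset.mem_univ, true_and]
  have sigma_ne : ∀ (i : ℕ) (hi : i < n) (C : PBond P (j + i + 1)), (i ≠ κ ∨ (∃ h : i = κ, h ▸ C ≠ c)) →
      (⟨⟨i, hi⟩, C⟩ : Σ i : Fin n, PBond P (j + i + 1)) ≠ σ := by
    intro i hi C h heq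
    rw [hσ] at heq
    have h1 : (⟨i, hi⟩ : Fin n) = ⟨κ, hκ⟩ := congrArg Sigma.fst heq
    have hik : i = κ := congrArg Fin.val h1
    subst hik
    rcases h with h | ⟨_, h⟩
    · exact h rfl
    · exact h (eq_of_heq (Sigma.mk.inj_iff.1 heq).2)
  have hS₁c : ∀ i, i < n → S₁ i ⊆ Sc i := by
    intro i hi C hC
    rw [memSc i hi]
    rcases Finset.mem_insert.1 ((memS₁ i hi C).1 hC) with h | h
    · rw [h]; exact hσs
    · exact hs's h
  have hV₁s : ∀ i, i < n → ∀ U, V (insert σ s') (i + 1) U = fun C => if C ∈ S₁ i then avgFun ℰ (V (insert σ s') i U) C else axialAvg (V (insert σ s') i U) C := by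
    intro i hi U
    have : S₁ i = Finset.univ.filter fun c' => (⟨⟨i, hi⟩, c'⟩ : Σ i : Fin n, PBond P (j + i + 1)) ∈ insert σ s' := by simp only [hS₁, dif_pos hi]
    rw [this]; exact hVs _ i hi U
  have hV₂s : ∀ i, i < n → ∀ U, V s' (i + 1) U = fun C => if C ∈ S₂ i then avgFun ℰ (V s' i U) C else axialAvg (V s' i U) C := by
    intro i hi U
    have : S₂ i = Finset.univ.filter fun c' => (⟨⟨i, hi⟩, c'⟩ : Σ i : Fin n, PBond P (j + i + 1)) ∈ s' := by simp only [hS₂, dif_pos hi]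
    rw [this]; exact hVs _ i hi U
  have hs : ∀ i, i ≠ κ → S₁ i = S₂ i := by
    intro i hiκ
    by_cases hi : i < n
    · ext C
      rw [memS₁ i hi, memS₂ i hi, Finset.mem_insert, or_iff_right]
      exact sigma_ne i hi C (Or.inl hiκ)
    · simp only [hS₁, hS₂, dif_neg hi]
  have hsκ : ∀ C : PBond P (j + κ + 1), C ≠ c → (C ∈ S₁ κ ↔ C ∈ S₂ κ) := by
    intro C hC
    rw [memS₁ κ hκ, memS₂ κ hκ, Finset.mem_insert, or_iff_right]
    exact sigma_ne κ hκ C (Or.inr ⟨rfl, hC⟩)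
  have htunread' : ∀ i, κ + 1 ≤ i → i < m + 1 → ∀ C ∈ Sc i, ∀ (ι : Idx P), ∀ st ∈ walk (emb C.src) (loopWord P.L C.dir (off ι.1) ι.2.1 ι.2.2), st.bond ≠ t i :=
    fun i hi1 hi2 C hC => htunread i hi1 hi2 C ((memSc i (by omega) C).1 hC)
  have hevent : ∀ s₀ : Finset (Σ i : Fin n, PBond P (j + i + 1)),
      (⋂ τ ∈ s, {U : GaugeField P j G | Small ℰ (V s₀ τ.1 U) τ.2}) = {U : GaugeField P j G | ∀ i, i < n → ∀ c' ∈ Sc i, Small ℰ (V s₀ i U) c'} := by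
    intro s₀
    ext U
    simp only [Set.mem_iInter, Set.mem_setOf_eq]
    constructor
    · intro h i hi C hC
      exact h ⟨⟨i, hi⟩, C⟩ ((memSc i hi C).1 hC)
    · rintro h ⟨⟨i, hi⟩, C⟩ hτ
      exact h i hi C ((memSc i hi C).2 hτ)
  rw [hevent, hevent]
  exact measure_guardAll_inter_preimage_eq_of_deadTower ℰ Sc S₁ S₂ hS₁c (V (insert σ s')) (V s') (hV0 _) (hV0 _) hV₁s hV₂s hjn hκm hmn c hs hsκ
    t τ htc htower htunread' hdead B _

end Summit.QuantumFields.YangMills.Theorems.UV3BranchExpansionMuteCancellationDead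

end
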